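import Literature.AnabelianGeometry.EtaleTheta.ThetaFrobenioidToyGenuine
import Literature.AnabelianGeometry.EtaleTheta.Discharge.Sec3RealifiedCuspidal

/-!
# [EtTh] Example 3.9 (iv) "`Φ_α^ell` is cuspidally pure" (`Example39Data.Example39_iv_cuspidallyPure`,
# FACT-LIST F-0615): instance form PROVED at the tree's toy Frobenioid, universal closure REFUTED (proof-only)

S. Mochizuki, *The étale theta function and its Frobenioid-theoretic manifestations*, Publ. RIMS **45**
(2009) [MochizukiEtTh2009], Example 3.9 (iv), PDF p. 85 (printed p. 311): "This monoid `Φ_α^ell` … it follows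
immediately from the above discussion that … `Φ_α^ell` is … cuspidally pure [cf. the well-known structure of
the special fibers of the 'universal combinatorial coverings']"; Def. 3.6 (v) p. 78 (printed 304): "`Φ` is
*cuspidally pure* if (a) for every non-cuspidal primary element `x ∈ Φ(A)` there exists `y ∈ Φ^{bs-fld}(A)` such
that `x ≤ y`; (b) `Prime(Φ(A)) = Prime(Φ(A))^ncsp ∪ Prime(Φ(A))^csp` [disjoint union]"
[cite: MochizukiEtTh2009, Ex 3.9 p.85] [cite: MochizukiEtTh2009, Def 3.6 p.78].

abc-iut cell, block C / F (FACT-PROVING WAVE, tranche 144, seat abc-iut-f-144), row **F-0615**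
`Example39Data.Example39_iv_cuspidallyPure` (abc-iut-L2-t3, `ThetaFrobenioid.lean`:
`(E.thetaFrobenioid α h).IsCuspidallyPure`), a `parametrised` schema over the abstract Ex. 3.9 (i)–(iii) datum
`E : Example39Data V DW TW`, the morphism `α` and the hypothesis record `h : E.FrobenioidHyp α VD` (FACT-LIST rule
R5: consumed at NAMED instances — `Discharge/Sec5Prop51Example39*.lean` take it as the binder `hcp`; a universal
closure is not a fact). PROOF-ONLY companion (0 definitions); inputs BY NAME: abc-iut-w5-d164's named toy
`Toy.example39Data` / `Toy.frobenioidHyp_example39Data` / `Toy.thetaFrobenioidGenuine`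
(`ThetaFrobenioidToyGenuine.lean`, p429770: one-object base, `Φ₀ = ℕ`, `Φ = im(ℕ^pf → ℕ^rlf)`, `Φ^{bs-fld} = Φ`,
`α = 𝟙`, realified data `Toy.realifiedGenuine = ofRlfZ Toy.divisorMonoids _` with EVERY log-divisor
non-cuspidal: `ncsp₀ = ⊤`, `csp₀ = ⊥`), abc-iut-L6-t12's support reading of Def. 3.6 (iii)
(`RealifiedDivisorMonoidsOfRlf.lean`: `ncspR/cspR = rlfSuppIn (toRSuppOf ncsp₀/csp₀)`) and support lemmas
(`Discharge/Sec3RealifiedCuspidal.lean`).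

WHAT IS PROVED.
* `RealifiedDivisorMonoids.toRSuppOf_bot` — no prime "arises from" the trivial submonoid: `toRSuppOf dm hpf Y ⊥ = ∅`;
  hence (`Toy.eq_one_of_isCuspidal_toy`) at the toy a cuspidal element of `Φ^{ℝ-log}` is `1`.
* `Toy.supp_subset_toRSuppOf_top_of_mem_pfImage` — every element of `Φ = im(Φ₀^pf → Φ₀^rlf)` is supported in
  the primes arising from `Φ₀ = ncsp₀`: at the toy EVERY divisor is non-cuspidal.
* **`Toy.isCuspidallyPure_thetaFrobenioidGenuine`** / **`Toy.example39_iv_cuspidallyPure_toy`** — Def. 3.6 (v)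
  (a)+(b) HOLD for "the tempered Frobenioid of Example 3.9 (iv)" at the toy datum: (a) `y := x` (`Φ^{bs-fld} = Φ`);
  (b) every prime is non-cuspidal, and no prime is cuspidal (its primary elements are `≠ 1`). INSTANCE FORM of
  F-0615 PROVED (at a degenerate but genuine-vocabulary instance).
* **`Example39Data.not_forall_example39_iv_cuspidallyPure`** — the UNIVERSAL CLOSURE of the typed row is
  FALSE: replacing, in the toy's Def. 3.6 (i) realified data, the cuspidal part by `cspR := ⊤` (every element
  of `Φ₀^ℝ` "arises from a cuspidal log-divisor" — the interface `RealifiedDivisorMonoids` records no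
  disjointness of `ncspR`/`cspR`, cf. abc-iut-L6-t12's (R2) `Disjoint (toRSuppOf ncsp₀) (toRSuppOf csp₀)` input)
  keeps `Example39Data` and `FrobenioidHyp` intact (they never mention `cspR`) but makes the unique prime of
  `Φ(A) ≅ ℚ_{≥0}` both non-cuspidal and cuspidal, violating (b)'s disjointness.

HONEST FRAMING: statements about the cell's own typing of a refereed [EtTh] sentence over abstract data,
evaluated at DEGENERATE consistency witnesses (one object, one prime, all functions constant) — not the theta
Frobenioid of a curve; the printed Example 3.9 (iv) is neither refuted nor proved here; a FACT row is an
assumption label, not an endorsement; nothing bears on [IUTchIII] Cor. 3.12; no side is taken; typed ≠ proved.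
-/

noncomputable section

namespace Literature.AnabelianGeometry.EtaleTheta

open CategoryTheory Opposite Literature.AlgebraicGeometry.Frobenioids

universe u v w

/-! ## 1. No prime arises from the trivial submonoid -/

namespace RealifiedDivisorMonoids

variable {D₀ : Type u} [Category.{v} D₀] (dm : DivisorMonoids.{u, v, w} D₀)
  (hpf : ∀ Y : D₀ᵒᵖ, IsPerfFactorial (dm.Φ₀.obj Y))

/-- The set of primes "arising from" the trivial submonoid `N = 1 ⊆ Φ₀(Y)` is empty (`ι(1) = 1` has empty
support). [cite: MochizukiEtTh2009, Def 3.6 p.77] -/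
theorem toRSuppOf_bot (Y : D₀ᵒᵖ) : toRSuppOf dm hpf Y ⊥ = ∅ := by
  rw [Set.eq_empty_iff_forall_notMem]
  intro 𝔮 h
  rw [toRSuppOf, Set.mem_iUnion₂] at h
  obtain ⟨a, ha, h𝔮⟩ := h
  rw [SetLike.mem_coe, Submonoid.mem_bot] at ha
  subst ha
  change ((hpf Y).toRealification (Perfection.of _ (1 : dm.Φ₀.obj Y))).1 𝔮 ≠ 1 at h𝔮
  rw [map_one, map_one] at h𝔮
  exact h𝔮 rfl

/-- For the CONSTRUCTED Def. 3.6 (i) data `ofRlfZ`: if NO log-divisor of `Φ₀(Y)` is cuspidal (`csp₀(Y) = 1`), then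
the only cuspidal element of `Φ₀^ℝ(Y)` is `1`. [cite: MochizukiEtTh2009, Def 3.6 p.77] -/
theorem eq_one_of_mem_cspR_of_csp₀_eq_bot (Y : D₀ᵒᵖ) (h0 : dm.csp₀ Y = ⊥) {x : (hpf Y).Rlf}
    (hx : x ∈ (ofRlfZ dm hpf).cspR Y) : x = 1 := by
  change supp ((hpf Y).realification.subtype x) ⊆ toRSuppOf dm hpf Y (dm.csp₀ Y) at hx
  rw [h0, toRSuppOf_bot] at hx
  exact Subtype.ext (eq_one_of_supp_subset_empty hx)

end RealifiedDivisorMonoids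

/-! ## 2. The toy: every divisor is non-cuspidal, none but `1` is cuspidal, `Φ^{bs-fld} = Φ` -/

namespace Toy

open Example39NV RealifiedDivisorMonoids

/-- At the toy (`ncsp₀ = Φ₀`): every element of `Φ(Y) = im(Φ₀^pf → Φ₀^rlf)` is supported in the primes arising
from the non-cuspidal log-divisors, i.e. is NON-CUSPIDAL in `Φ₀^ℝ(Y)` (`ι^pf(a)^n = ι(m)` for `a = m^{1/n}`,
and supports are invariant under powers). [cite: MochizukiEtTh2009, Def 3.6 p.77] -/
theorem supp_subset_toRSuppOf_top_of_mem_pfImage (Y : (Discrete PUnit.{1})ᵒᵖ)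
    {x : realifiedGenuine.ΦR.obj Y} (hx : x ∈ pfImage Y) :
    supp ((isPerfFactorial_Φ₀ Y).realification.subtype x) ⊆ toRSuppOf divisorMonoids isPerfFactorial_Φ₀ Y ⊤ := by
  obtain ⟨a, ha⟩ := hx
  have ha' : (isPerfFactorial_Φ₀ Y).toRealification a = x := ha
  subst ha'
  obtain ⟨⟨m, n⟩, rfl⟩ := Perfection.mk_surjective a
  dsimp only
  rw [← supp_pow_eq _ n.ne_zero, ← map_pow, ← map_pow, Perfection.mk_pow_self]
  exact supp_toR_subset_toRSuppOf divisorMonoids isPerfFactorial_Φ₀ Y (Submonoid.mem_top m)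

/-- Hence every element of `Φ(Y)` lies in the non-cuspidal part `Φ₀^ℝ(Y)^ncsp` of the toy's realified data.
[cite: MochizukiEtTh2009, Def 3.6 p.77] -/
theorem mem_ncspR_of_mem_pfImage (Y : (Discrete PUnit.{1})ᵒᵖ) {x : realifiedGenuine.ΦR.obj Y}
    (hx : x ∈ pfImage Y) : x ∈ realifiedGenuine.ncspR Y :=
  supp_subset_toRSuppOf_top_of_mem_pfImage Y hx

/-- … and an element of `Φ₀^ℝ(Y)` that is CUSPIDAL for the toy's realified data is `1` (`csp₀ = 1`).
[cite: MochizukiEtTh2009, Def 3.6 p.77] -/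
theorem eq_one_of_mem_cspR_toy (Y : (Discrete PUnit.{1})ᵒᵖ) {x : realifiedGenuine.ΦR.obj Y}
    (hx : x ∈ realifiedGenuine.cspR Y) : x = 1 :=
  eq_one_of_mem_cspR_of_csp₀_eq_bot divisorMonoids isPerfFactorial_Φ₀ Y rfl hx

variable (R S : ((Example39Data.Dα (𝟙 basePt))ᵒᵖ ⥤ CommMonCat.{0}) → Prop)

/-! ## 3. Instance form of F-0615 at the toy: Def. 3.6 (v) holds for `Toy.thetaFrobenioidGenuine` -/

/-- **Def. 3.6 (v) HOLDS for "the tempered Frobenioid of Example 3.9 (iv)" at the toy datum**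
(`Toy.thetaFrobenioidGenuine R S = Toy.example39Data.thetaFrobenioid (𝟙 _) (Toy.frobenioidHyp_example39Data R S)`):
(a) every (non-cuspidal primary) `x ∈ Φ_α^ell(A)` is bounded by the base-field-theoretic `y := x`
(`Φ^{bs-fld} = Φ`, `Toy.of_mem_cnstR_of_mem_pfImage`); (b) every prime of `Φ_α^ell(A)` is non-cuspidal, and none
is cuspidal (a cuspidal primary element would be `1`). [cite: MochizukiEtTh2009, Def 3.6 p.78] -/
theorem isCuspidallyPure_thetaFrobenioidGenuine : (thetaFrobenioidGenuine R S).IsCuspidallyPure where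
  exists_bsFld_dvd A x _ _ :=
    ⟨x, Submonoid.mem_inf.mpr ⟨x.2, of_mem_cnstR_of_mem_pfImage _ x.2⟩, dvd_rfl⟩
  ncsp_or_csp A 𝔭 := Or.inl fun x _ => mem_ncspR_of_mem_pfImage _ x.2
  not_ncsp_and_csp A 𝔭 := by
    rintro ⟨-, hcsp⟩
    obtain ⟨⟨a, ha⟩, rfl⟩ := Quotient.mk_surjective 𝔭
    have hmem : a ∈ Primes.carrier (Quotient.mk (primarySetoid _) ⟨a, ha⟩) := ⟨ha, rfl⟩
    have h1 := eq_one_of_mem_cspR_toy _ (hcsp a hmem)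
    exact ha.1 (Subtype.ext h1)

/-- **F-0615, INSTANCE FORM PROVED**: abc-iut-L2-t3's named fact `Example39Data.Example39_iv_cuspidallyPure` holds
at the named toy datum `Toy.example39Data`, `α := 𝟙`, `h := Toy.frobenioidHyp_example39Data R S` (for every choice
of the two [FrdI] Def. 4.5 predicates `R`, `S` of `treeCatVocab`). [cite: MochizukiEtTh2009, Ex 3.9 p.85] -/
theorem example39_iv_cuspidallyPure_toy :
    example39Data.Example39_iv_cuspidallyPure (𝟙 basePt) (frobenioidHyp_example39Data R S) :=
  isCuspidallyPure_thetaFrobenioidGenuine R S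

/-- `Φ_α^ell(A)` of the toy has a prime (it is monoprime and `ι(of 1) ≠ 1`). [cite: MochizukiEtTh2009, Ex 3.9 p.85] -/
theorem nonempty_primes_pfImage (Y : (Discrete PUnit.{1})ᵒᵖ) : Nonempty (Primes ↥(pfImage Y)) :=
  MonoprimeStructure.primes_nonempty (fun _ _ hb => MonoprimeStructure.precsim_of_ne_one (isMonoprime_pfImage Y) hb)
    (ε := ⟨_, ⟨Perfection.of _ (Multiplicative.ofAdd (1 : ℕ)), rfl⟩⟩)
    (fun h => toRealification_of_ofAdd_one_ne_one Y (congrArg Subtype.val h))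

end Toy

/-! ## 4. The universal closure of F-0615 is false -/

namespace Example39Data

open Toy Example39NV RealifiedDivisorMonoids

/-- **The universal closure of the typed [EtTh] Example 3.9 (iv) clause "`Φ_α^ell` is cuspidally pure"
(`Example39Data.Example39_iv_cuspidallyPure`, FACT-LIST F-0615) is FALSE**: over the toy's base and vocabulary,
the Def. 3.6 (i) realified data with `cspR := ⊤` (every element of `Φ₀^ℝ` declared cuspidal; `ncspR` untouched)
carries the SAME Ex. 3.9 (i)–(iii) datum and the SAME `FrobenioidHyp` (neither mentions `cspR`), but the prime of
`Φ_α^ell(A)` is then both non-cuspidal and cuspidal — Def. 3.6 (v)(b)'s disjointness fails. Nothing printed is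
refuted (the interface does not record that cuspidal and non-cuspidal supports are disjoint).
[cite: MochizukiEtTh2009, Ex 3.9 p.85] -/
theorem not_forall_example39_iv_cuspidallyPure
    (R S : ((Example39Data.Dα (𝟙 Toy.basePt))ᵒᵖ ⥤ CommMonCat.{0}) → Prop) :
    ¬ ∀ (TW : RealifiedDivisorMonoids (D₀ := Discrete PUnit.{1}) treeMonoidVocab.{0})
        (E : Example39Data treeMonoidVocab.{0} (Discrete PUnit.{1}) TW)
        (h : E.FrobenioidHyp (𝟙 Toy.basePt) (treeCatVocab (Example39Data.Dα (𝟙 Toy.basePt)) R S)),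
        E.Example39_iv_cuspidallyPure (𝟙 Toy.basePt) h := by
  intro hall
  -- the toy's realified data with EVERY element of `Φ₀^ℝ` declared cuspidal
  let TW : RealifiedDivisorMonoids (D₀ := Discrete PUnit.{1}) treeMonoidVocab.{0} :=
    { Toy.realifiedGenuine with
      cspR := fun _ => ⊤
      toR_csp := fun _ _ _ => Submonoid.mem_top _ }
  -- the same Ex. 3.9 (i)–(iii) datum over it
  let E : Example39Data treeMonoidVocab.{0} (Discrete PUnit.{1}) TW :=
    { DU := Discrete PUnit.{1}
      DX := Discrete PUnit.{1}
      DY := Discrete PUnit.{1}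
      fUX := 𝟭 _
      fUY := 𝟭 _
      fXW := 𝟭 _
      fYW := 𝟭 _
      oneComm := Iso.refl _
      ellY := ⊤
      ellW := ⊤
      toEllY := (ObjectProperty.topEquivalence (Discrete PUnit.{1})).inverse
      adjY := (ObjectProperty.topEquivalence (Discrete PUnit.{1})).symm.toAdjunction
      toEllW := (ObjectProperty.topEquivalence (Discrete PUnit.{1})).inverse
      adjW := (ObjectProperty.topEquivalence (Discrete PUnit.{1})).symm.toAdjunction
      ΦellW := Toy.pfSubMonoidOn
      isPerfect := Toy.example39Data.isPerfect
      isGroupSaturated := Toy.example39Data.isGroupSaturated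
      isPerfFactorial := Toy.example39Data.isPerfFactorial
      isNonDilating := Toy.example39Data.isNonDilating }
  -- the same Def. 3.6 (ii) conditions (they do not mention `cspR`)
  have hE : E.FrobenioidHyp (𝟙 Toy.basePt) (treeCatVocab (Example39Data.Dα (𝟙 Toy.basePt)) R S) :=
    { isConnected := (Toy.frobenioidHyp_example39Data R S).isConnected
      isTotallyEpimorphic := (Toy.frobenioidHyp_example39Data R S).isTotallyEpimorphic
      isDivisorialOn := (Toy.frobenioidHyp_example39Data R S).isDivisorialOn
      isMonoprime_bsFld := (Toy.frobenioidHyp_example39Data R S).isMonoprime_bsFld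
      exists_FΛ_div_ne := (Toy.frobenioidHyp_example39Data R S).exists_FΛ_div_ne }
  have hpure := hall TW E hE
  -- an object of `D_α` and a prime of `Φ_α^ell` over it
  obtain ⟨X⟩ := Toy.nonempty_Dα
  obtain ⟨𝔭⟩ := Toy.nonempty_primes_pfImage (op ((Example39Data.toDW (𝟙 Toy.basePt)).obj X))
  refine hpure.not_ncsp_and_csp (op X) 𝔭 ⟨fun x _ => ?_, fun x _ => ?_⟩
  · -- non-cuspidal: as at the toy
    exact Toy.mem_ncspR_of_mem_pfImage _ x.2
  · -- cuspidal: everything is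
    exact Submonoid.mem_top _

end Example39Data

end Literature.AnabelianGeometry.EtaleTheta

end
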